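import Summits.ResolutionOfSingularities.ResolutionOfSingularities.Theorems.TowerCutChart
import Mathlib.RingTheory.Polynomial.Eisenstein.Basic
import Mathlib.RingTheory.Polynomial.GaussLemma
import Mathlib.RingTheory.DiscreteValuationRing.TFAE
import Mathlib.Algebra.Polynomial.Reverse

/-!
# ConeJumpAlg — irreducible fibres of the normal cone: PID localisations, reflection, Eisenstein over the curve,
linear forms in regular parameters

Slice 1/3 of the node «JumpCut» (`decomp-res-lens-2` g30; engine letter `CurveLeafExit.NormalConeJumpExit`,
proved in slice 3/3 `MaxContactCutConeJump`).  Pure commutative algebra: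

* `isUnit_or_not_mem_sq_of_irreducible` — in a local ring `L` which is a localisation of a principal ideal
  domain `R`, an irreducible `E ∈ R` becomes a unit or lies outside `𝔪_L²`;
* `irreducible_C_mul_X_pow_add_one` — over a field, `Xⁿ + a` irreducible (`a ≠ 0`, `0 < n`) forces `a Xⁿ + 1`
  irreducible (reflection `X ↦ 1/X`; `isUnit_of_isUnit_reflect`);
* `irreducible_X_pow_add_C_of_uniformizer` — over the fraction field `K` of a Noetherian local domain `D` whose
  maximal ideal is principal `(w)`, `Xⁿ + λ w` is irreducible for every unit `λ` (Eisenstein at `(w)` + Gauss's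
  lemma; `D` is a DVR by `IsDiscreteValuationRing.TFAE`);
* `sum_mul_not_mem_sq_of_isRsopPart` — a linear form in part of a regular system of parameters with a unit
  coefficient is not in `𝔪²` (quasi-regularity in degree one).

Sources: [Matsumura1987] Thms. 14.2, 16.2 (regular systems of parameters, quasi-regularity), Thm. 11.2 (DVR
characterisations); Eisenstein's criterion and Gauss's lemma (Mathlib); [Hironaka1964] Ch. III §1 (normal cones
along a regular centre).
-/

open IsLocalRing Polynomial
open Literature.AlgebraicGeometry.Resolution

namespace Summit.ResolutionOfSingularities.ResolutionOfSingularities.Theorems.ConeJump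

/-! ## §1  Irreducible elements of a PID in a local localisation -/

/-- **An irreducible element of a principal ideal domain is a unit or a uniformizer-to-first-order in every local
localisation**: if `L` is a local ring which is a localisation of the PID `R` and `E ∈ R` is irreducible, then the
image of `E` in `L` is a unit or does not lie in `𝔪_L²`. [folklore] -/
theorem isUnit_or_not_mem_sq_of_irreducible {R L : Type} [CommRing R] [IsDomain R] [IsPrincipalIdealRing R]
    [CommRing L] [IsLocalRing L] (M : Submonoid R) (ρ : R →+* L)
    (hloc : @IsLocalization R _ M L _ ρ.toAlgebra) {E : R} (hE : Irreducible E) :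
    IsUnit (ρ E) ∨ ρ E ∉ maximalIdeal L ^ 2 := by
  classical
  letI := ρ.toAlgebra
  haveI : IsLocalization M L := hloc
  have hρ : ∀ x, algebraMap R L x = ρ x := fun _ => rfl
  set 𝔮 : Ideal R := (maximalIdeal L).comap (algebraMap R L) with h𝔮
  by_cases hEq : E ∈ 𝔮
  · right
    have hne : 𝔮 ≠ ⊥ := fun h => hE.ne_zero (by simpa [h] using hEq)
    set p : R := Submodule.IsPrincipal.generator 𝔮 with hpdef
    have hp : Prime p := Submodule.IsPrincipal.prime_generator_of_isPrime 𝔮 hne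
    have h𝔮p : 𝔮 = Ideal.span {p} := (Ideal.span_singleton_generator 𝔮).symm
    have hpmem : p ∈ 𝔮 := Submodule.IsPrincipal.generator_mem 𝔮
    -- `𝔪_L = (ρ p)`
    have hmax : maximalIdeal L = Ideal.span {algebraMap R L p} := by
      rw [← IsLocalization.map_under M L (maximalIdeal L)]
      change Ideal.map (algebraMap R L) 𝔮 = _
      rw [h𝔮p, Ideal.map_span, Set.image_singleton]
    -- elements of `M` are prime to `p`
    have hpM : ∀ m : R, m ∈ M → ¬ p ∣ m := fun m hm hdvd => by
      have hu : IsUnit (algebraMap R L m) := IsLocalization.map_units L ⟨m, hm⟩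
      have hpu : IsUnit (algebraMap R L p) := isUnit_of_dvd_unit (map_dvd _ hdvd) hu
      exact (IsLocalRing.notMem_maximalIdeal.mpr hpu) (Ideal.mem_comap.mp hpmem)
    intro hmem
    rw [hmax, Ideal.span_singleton_pow, ← map_pow] at hmem
    have hmem' : algebraMap R L E ∈ (Ideal.span {p ^ 2}).map (algebraMap R L) := by
      rw [Ideal.map_span, Set.image_singleton]; exact hmem
    rw [IsLocalization.mem_map_algebraMap_iff M L] at hmem'
    obtain ⟨⟨⟨y, hy⟩, ⟨s, hs⟩⟩, hys⟩ := hmem'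
    dsimp only at hys
    rw [← map_mul] at hys
    obtain ⟨⟨c', hc'M⟩, hc'⟩ := (IsLocalization.eq_iff_exists M L).mp hys
    dsimp only at hc'
    obtain ⟨w, rfl⟩ := Ideal.mem_span_singleton'.mp hy
    -- `p ∣ E`
    have h1 : p ∣ c' * (E * s) := by
      refine ⟨c' * w * p, ?_⟩
      rw [hc']; ring
    have hpE : p ∣ E := by
      rcases hp.dvd_or_dvd h1 with h | h
      · exact absurd h (hpM c' hc'M)
      rcases hp.dvd_or_dvd h with h | h
      · exact h
      · exact absurd h (hpM s hs)
    obtain ⟨u, hu⟩ := hpE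
    have huu : IsUnit u := (hE.isUnit_or_isUnit hu).resolve_left hp.not_unit
    -- `p² ∣ c' E s = c' p u s` gives `p ∣ c' u s`
    have h2 : p * p ∣ p * (c' * (u * s)) := by
      refine ⟨c' * w, ?_⟩
      have : p * (c' * (u * s)) = c' * (E * s) := by rw [hu]; ring
      rw [this, hc']; ring
    have h3 : p ∣ c' * (u * s) := (mul_dvd_mul_iff_left hp.ne_zero).mp h2
    rcases hp.dvd_or_dvd h3 with h | h
    · exact hpM c' hc'M h
    rcases hp.dvd_or_dvd h with h | h
    · exact hp.not_unit (isUnit_of_dvd_unit h huu)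
    · exact hpM s hs h
  · left
    exact IsLocalRing.notMem_maximalIdeal.mp (fun h => hEq (Ideal.mem_comap.mpr h))

/-! ## §2  Reflection: `Xⁿ + a` irreducible forces `a Xⁿ + 1` irreducible -/

/-- If `a Xⁿ + 1 = p q` (`n ≥ 1`) and the reflection of `p` is a unit then `p` is a unit. [folklore] -/
theorem isUnit_of_isUnit_reflect {k : Type} [Field k] {n : ℕ} (hn : 0 < n) {a : k} {p q : k[X]}
    (hpq : C a * X ^ n + 1 = p * q) (hu : IsUnit (reflect p.natDegree p)) : IsUnit p := by
  obtain ⟨b, hb, hbp⟩ := Polynomial.isUnit_iff.mp hu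
  have hp : p = C b * X ^ p.natDegree := by
    have h := congr_arg (reflect p.natDegree) hbp
    rw [reflect_reflect, reflect_C] at h
    exact h.symm
  have hN : p.natDegree = 0 := by
    by_contra hN
    have h := congr_arg (Polynomial.eval 0) hpq
    rw [hp] at h
    simp [zero_pow hn.ne', zero_pow hN] at h
  rw [hp, hN, pow_zero, mul_one]
  exact Polynomial.isUnit_C.mpr hb

/-- **Reflection of `Xⁿ + a`**: over a field, if `Xⁿ + a` is irreducible and `a ≠ 0`, `n ≥ 1`, then `a Xⁿ + 1` is
irreducible (a factorisation of `a Xⁿ + 1` reflects to one of `Xⁿ + a`). [folklore] -/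
theorem irreducible_C_mul_X_pow_add_one {k : Type} [Field k] {n : ℕ} (hn : 0 < n) {a : k} (ha : a ≠ 0)
    (h : Irreducible (X ^ n + C a : k[X])) : Irreducible (C a * X ^ n + 1 : k[X]) := by
  classical
  have hG0 : (C a * X ^ n + 1 : k[X]) ≠ 0 := fun h0 => by
    have := congr_arg (Polynomial.eval 0) h0
    simp [zero_pow hn.ne'] at this
  have hGdeg : (C a * X ^ n + 1 : k[X]).natDegree = n := by
    rw [natDegree_add_eq_left_of_natDegree_lt] <;> simp [natDegree_C_mul_X_pow n a ha, hn]
  have hrefl : reflect n (C a * X ^ n + 1 : k[X]) = X ^ n + C a := by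
    rw [reflect_add, reflect_C_mul_X_pow, reflect_one, revAt_le le_rfl, Nat.sub_self, pow_zero, mul_one,
      add_comm]
  refine ⟨fun hu => ?_, fun p q hpq => ?_⟩
  · have := natDegree_eq_zero_of_isUnit hu
    omega
  · have hp0 : p ≠ 0 := fun h0 => hG0 (by rw [hpq, h0, zero_mul])
    have hq0 : q ≠ 0 := fun h0 => hG0 (by rw [hpq, h0, mul_zero])
    have hdeg : p.natDegree + q.natDegree = n := by rw [← natDegree_mul hp0 hq0, ← hpq, hGdeg]
    have hE : (X ^ n + C a : k[X]) = reflect p.natDegree p * reflect q.natDegree q := by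
      rw [← hrefl, hpq, ← hdeg, reflect_mul p q le_rfl le_rfl]
    rcases h.isUnit_or_isUnit hE with hu | hu
    · exact Or.inl (isUnit_of_isUnit_reflect hn hpq hu)
    · exact Or.inr (isUnit_of_isUnit_reflect hn (by rw [hpq, mul_comm]) hu)

/-! ## §3  Eisenstein over the local ring of the curve -/

/-- **`Xⁿ + λ w` is irreducible over the fraction field of a discrete valuation ring with uniformizer `w`**
(`λ` a unit, `n ≥ 1`): Eisenstein at `(w)` and Gauss's lemma; the ring is given as a Noetherian local domain whose
maximal ideal is `(w)`, `w ≠ 0`. [folklore] -/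
theorem irreducible_X_pow_add_C_of_uniformizer {D K : Type} [CommRing D] [IsDomain D] [IsNoetherianRing D]
    [IsLocalRing D] [Field K] [Algebra D K] [IsFractionRing D K] {w l : D}
    (hw : maximalIdeal D = Ideal.span {w}) (hw0 : w ≠ 0) (hl : IsUnit l) {n : ℕ} (hn : 0 < n) :
    Irreducible (X ^ n + C (algebraMap D K (l * w)) : K[X]) := by
  classical
  have htf := tfae_of_isNoetherianRing_of_isLocalRing_of_isDomain (R := D)
  have hpr : (maximalIdeal D).IsPrincipal := ⟨⟨w, hw⟩⟩
  have h43 : (maximalIdeal D).IsPrincipal ↔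
      (IsIntegrallyClosed D ∧ ∀ P : Ideal D, P ≠ ⊥ → P.IsPrime → P = maximalIdeal D) := htf.out 4 3
  haveI : IsIntegrallyClosed D := (h43.mp hpr).1
  have hmonic : (X ^ n + C (l * w) : D[X]).Monic := monic_X_pow_add_C _ hn.ne'
  have hdeg : (X ^ n + C (l * w) : D[X]).natDegree = n := natDegree_X_pow_add_C
  have heis : (X ^ n + C (l * w) : D[X]).IsEisensteinAt (maximalIdeal D) := by
    refine ⟨?_, fun {m} hm => ?_, ?_⟩
    · rw [hmonic.leadingCoeff]
      exact fun h1 => (maximalIdeal.isMaximal D).ne_top ((Ideal.eq_top_iff_one _).mpr h1)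
    · rw [hdeg] at hm
      rw [coeff_add, coeff_X_pow, if_neg hm.ne, zero_add, coeff_C]
      split_ifs
      · rw [hw]; exact Ideal.mul_mem_left _ _ (Ideal.mem_span_singleton_self w)
      · exact Ideal.zero_mem _
    · rw [coeff_add, coeff_X_pow, if_neg (Nat.pos_iff_ne_zero.mp hn).symm, zero_add, coeff_C, if_pos rfl, hw,
        Ideal.span_singleton_pow, Ideal.mem_span_singleton']
      rintro ⟨d, hd⟩
      have hl' : l = d * w := by
        have h : (l - d * w) * w = 0 := by rw [sub_mul, mul_assoc, ← pow_two, hd, sub_self]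
        rcases mul_eq_zero.mp h with h | h
        · exact sub_eq_zero.mp h
        · exact absurd h hw0
      refine (IsLocalRing.notMem_maximalIdeal.mpr hl) ?_
      rw [hl', hw]
      exact Ideal.mul_mem_left _ _ (Ideal.mem_span_singleton_self w)
  have hirr : Irreducible (X ^ n + C (l * w) : D[X]) :=
    heis.irreducible inferInstance hmonic.isPrimitive (by rw [hdeg]; exact hn)
  have h := (hmonic.irreducible_iff_irreducible_map_fraction_map (K := K)).mp hirr
  simpa [Polynomial.map_add, Polynomial.map_pow] using h

/-! ## §4  Linear forms in part of a regular system of parameters -/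

/-- **A linear form in part of a regular system of parameters with a unit coefficient is not in `𝔪²`**
(quasi-regularity of a regular system of parameters, degree one). [cite: Matsumura1987, Thm. 16.2 (i)] -/
theorem sum_mul_not_mem_sq_of_isRsopPart {S : Type} [CommRing S] [IsLocalRing S] {k : ℕ} {x : Fin k → S}
    (hx : IsRsopPart x) (a : Fin k → S) (i : Fin k) (hai : IsUnit (a i)) :
    ∑ j, a j * x j ∉ maximalIdeal S ^ 2 := by
  classical
  intro h
  haveI := hx.isRegularLocalRing
  obtain ⟨e, y, hd, hy, hyx⟩ := hx.exists_rsop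
  have hq : IsQuasiRegular (y ∘ id) := isQuasiRegular_rsop_comp hd y hy id Function.injective_id
  set F : MvPolynomial (Fin (k + e)) S := ∑ j : Fin k, MvPolynomial.C (a j) * MvPolynomial.X (Fin.castAdd e j)
    with hF
  have hhom : F.IsHomogeneous 1 := by
    refine MvPolynomial.IsHomogeneous.sum _ _ _ fun j _ => ?_
    simpa using (MvPolynomial.isHomogeneous_C _ (a j)).mul (MvPolynomial.isHomogeneous_X S (Fin.castAdd e j))
  have heval : MvPolynomial.eval (y ∘ id) F = ∑ j, a j * x j := by
    simp only [hF, map_sum, map_mul, MvPolynomial.eval_C, MvPolynomial.eval_X, Function.comp_apply, id, hyx]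
  have hmem : MvPolynomial.eval (y ∘ id) F ∈ Ideal.span (Set.range (y ∘ id)) ^ (1 + 1) := by
    rw [heval, Function.comp_id, hy]
    exact h
  have hFmem := hq 1 F hhom hmem
  have hcoeff : MvPolynomial.coeff (Finsupp.single (Fin.castAdd e i) 1) F ∈ Ideal.span (Set.range (y ∘ id)) :=
    MvPolynomial.mem_map_C_iff.mp hFmem _
  have hci : MvPolynomial.coeff (Finsupp.single (Fin.castAdd e i) 1) F = a i := by
    simp only [hF, MvPolynomial.coeff_sum, MvPolynomial.coeff_C_mul, MvPolynomial.coeff_X, mul_ite, mul_one,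
      mul_zero]
    rw [Finset.sum_eq_single i]
    · rw [if_pos rfl]
    · intro j _ hj
      rw [if_neg]
      intro hs
      exact hj (Fin.castAdd_injective _ _ (Finsupp.single_left_injective one_ne_zero hs))
    · intro hi; exact absurd (Finset.mem_univ i) hi
  rw [hci, Function.comp_id, hy] at hcoeff
  exact (IsLocalRing.notMem_maximalIdeal.mpr hai) hcoeff

end Summit.ResolutionOfSingularities.ResolutionOfSingularities.Theorems.ConeJump
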